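import Summits.Ventures.YMGap.RobustBall.PlaquettePositivityResample
import Literature.MathematicalPhysics.QuantumFieldTheory.StrongCouplingEuclidean
import HarnessLib

/-!
# Venture YMGap, track ROBUST-BALL — the plaquette first moment WITHOUT the `1/(2(d-1))` loss, I: resampling a private link

HONEST FRAMING. WHAT THIS IS: a venture file (cell `pub-ymgap`, track Y2, seat rb-p2 g6): LATTICE
statements about Wilson's `SU(N)` lattice gauge theory on `ℤ^d` (DLR description `ymSpecification`,
tree coupling `β`, weight `exp(-β S_W)`), valid at EVERY `β ≥ 0`, for every DLR state. WHAT IT IS NOT: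
nothing about the continuum limit, a spectral gap, or a Clay-sense mass gap.

Part I of two (`PlaquetteFirstMomentResample` → `PlaquetteFirstMoment`): the geometric and one-step
resampling lemmas (parts A–C below); the induction and the main result are in part II.

MAIN RESULT OF THE PAIR (`PlaquetteFirstMoment.integral_sum_plaquetteObs_ge_sum`). For `G ≅ SU(N)` (`IsSpecialUnitaryModel ρ`),
`N ≥ 2`, `d ≥ 2`, every `β ≥ 0`, every Gibbs measure `μ` of the Wilson specification and every link
`e` of `ℤ^d`, writing `D = 4(d-1)Nβ` and `V₀ = ∫_G (Re tr ρ)² dHaar` (`PlaquetteLowerBound.charVariance`):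

  `∫ ∑_{p ∋ e} Re tr ρ(U_p) dμ ≥ β e^{-D} V₀ ∑_{k=1}^{2(d-1)} e^{-kD}`.

rb-p2 g3's `PlaquettePositivity.integral_sum_plaquetteObs_ge` is the `k = 1` term alone
(`β e^{-2D} V₀`); summed over the `2(d-1)` plaquettes through `e` and distributed by symmetry
(`PlaquettePositivity.integral_plaquetteObs_eq`) the new bound gives the plaquette expectation of
every limit state the EXACT leading coefficient `u = β V₀/N` of the strong-coupling series
(`β_W/4` for `SU(2)`, `β_W/(2N²)` for `N ≥ 3`) up to a factor `e^{-O(β)}` — the structural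
`1/(2(d-1))` of g3/g5 (the additive `log(2(d-1))` on the ceiling side of the string-tension law) is
gone (file `StringTensionCeilingLinear`).

MECHANISM (elementary; no expansion, no reflection positivity). Let
`Q_S(η) = ∫ (∑_{p ∈ S} Re tr(ρ(g) ρ(staple_p^e(η))))² dg` for a set `S` of plaquettes through `e`.
Every plaquette `p ∋ e` has a link `f ≠ e` at which the staple is `a·h·b` in the variable `h` at `f`
(`exists_resampling_link`), and two distinct links lie on at most one plaquette
(`eq_of_two_links`), so NO OTHER staple at `e` reads `f` (`staple_update_eq_of_ne`). Resampling `f`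
by Haar measure therefore restores one full character variance and keeps the rest:
`∫ Q_S(η^{f ← h}) dh = Q_{S ∖ p}(η) + V₀` (`integral_integral_sq_sum_update`); through the DLR kernel
at `f` (density `≥ e^{-D}`) and the DLR equation, `∫ Q_S dμ ≥ e^{-D} (∫ Q_{S∖p} dμ + V₀)`, whence by
induction `∫ Q_S dμ ≥ V₀ ∑_{k=1}^{#S} e^{-kD}` (`integral_sq_sum_ge`); the source-response bound of
part I at `e` (`siteAvg_sum_plaquetteObs_ge`: `γ_e P_e ≥ β e^{-D} Q_T`) finishes.

References: E. Seiler, LNP 159 (1982), §2; H.-O. Georgii, *Gibbs Measures and Phase Transitions*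
(2011), Remark 1.24. Everything here is proved; no definition, no named fact. [folklore]
-/

noncomputable section

open MeasureTheory Filter Topology Finset
open Literature.Probability.LatticeModels Literature.Probability.LatticeModels.DobrushinMetric
open Literature.MathematicalPhysics.QuantumLattice Literature.MathematicalPhysics.QuantumFieldTheory

namespace Summit.Ventures.YMGap.RobustBall

namespace PlaquetteFirstMoment

open PlaquettePositivity

/-! ### Part A — geometry: a resampling link for every position of `e` on `p`; privacy -/

section Geometry

variable {d : ℕ} {G : Type*} [Group G]

/-- **A resampling link.** For every link `x` of the plaquette `p` there is another link `f ≠ x`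
of `p` such that, as a function of the variable `h` at `f`, the staple of `p` at `x` is `a·h·b`
with `a, b` not depending on `h` (the four positions of `x` on `p`: resample `plaqLink2`,
`plaqLink1`, `plaqLink4`, `plaqLink3` respectively). [folklore] -/
theorem exists_resampling_link (p : ZdPlaquette d)
    {x : Literature.MathematicalPhysics.QuantumLattice.ZdEdge d} (hx : x ∈ plaquetteEdges p) :
    ∃ f ∈ plaquetteEdges p, f ≠ x ∧ ∀ ω : LGConfig d G, ∃ a b : G, ∀ h : G,
      staple p x (Function.update ω f h) = a * h * b := by
  classical
  have h12 := plaqLink1_ne_plaqLink2 p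
  have h13 := plaqLink1_ne_plaqLink3 p
  have h14 := plaqLink1_ne_plaqLink4 p
  have h23 := plaqLink2_ne_plaqLink3 p
  have h24 := plaqLink2_ne_plaqLink4 p
  have h34 := plaqLink3_ne_plaqLink4 p
  have hm1 : plaqLink1 p ∈ plaquetteEdges p := by rw [plaquetteEdges_eq]; simp
  have hm2 : plaqLink2 p ∈ plaquetteEdges p := by rw [plaquetteEdges_eq]; simp
  have hm3 : plaqLink3 p ∈ plaquetteEdges p := by rw [plaquetteEdges_eq]; simp
  have hm4 : plaqLink4 p ∈ plaquetteEdges p := by rw [plaquetteEdges_eq]; simp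
  rw [plaquetteEdges_eq] at hx
  simp only [Finset.mem_insert, Finset.mem_singleton] at hx
  rcases hx with rfl | rfl | rfl | rfl
  · refine ⟨plaqLink2 p, hm2, h12.symm, fun ω => ⟨1, (ω (plaqLink3 p))⁻¹ * (ω (plaqLink4 p))⁻¹,
      fun h => ?_⟩⟩
    unfold staple
    rw [if_pos rfl, Function.update_self, Function.update_of_ne h23.symm,
      Function.update_of_ne h24.symm, one_mul, mul_assoc]
  · refine ⟨plaqLink1 p, hm1, h12, fun ω => ⟨(ω (plaqLink3 p))⁻¹ * (ω (plaqLink4 p))⁻¹, 1,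
      fun h => ?_⟩⟩
    unfold staple
    rw [if_neg h12.symm, if_pos rfl, Function.update_self, Function.update_of_ne h13.symm,
      Function.update_of_ne h14.symm, mul_one]
  · refine ⟨plaqLink4 p, hm4, h34.symm, fun ω => ⟨(ω (plaqLink2 p))⁻¹ * (ω (plaqLink1 p))⁻¹, 1,
      fun h => ?_⟩⟩
    unfold staple
    rw [if_neg h13.symm, if_neg h23.symm, if_pos rfl, Function.update_self,
      Function.update_of_ne h24, Function.update_of_ne h14, mul_one]
  · refine ⟨plaqLink3 p, hm3, h34, fun ω => ⟨1, (ω (plaqLink2 p))⁻¹ * (ω (plaqLink1 p))⁻¹,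
      fun h => ?_⟩⟩
    unfold staple
    rw [if_neg h14.symm, if_neg h24.symm, if_neg h34.symm, Function.update_self,
      Function.update_of_ne h23, Function.update_of_ne h13, one_mul, mul_assoc]

/-- **Privacy of the resampling link.** If `f ≠ x` are two links of `p` and `q ≠ p` is another
plaquette through `x`, then the staple of `q` at `x` does not read `f` (two distinct links lie on
at most one plaquette, `eq_of_two_links`). [folklore] -/
theorem staple_update_eq_of_ne {p q : ZdPlaquette d}
    {x f : Literature.MathematicalPhysics.QuantumLattice.ZdEdge d} (hxp : x ∈ plaquetteEdges p)
    (hfp : f ∈ plaquetteEdges p) (hfx : f ≠ x) (hxq : x ∈ plaquetteEdges q) (hqp : q ≠ p)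
    (ω : LGConfig d G) (h : G) : staple q x (Function.update ω f h) = staple q x ω := by
  classical
  refine staple_congr fun k => Function.update_of_ne ?_ _ _
  intro hk
  have hfq : f ∈ plaquetteEdges q := hk ▸ stapleLinks_mem_plaquetteEdges q x k
  exact hqp (eq_of_two_links hfx.symm hxq hfq hxp hfp)

end Geometry

/-! ### Part B — resampling one private link restores one character variance and keeps the rest -/

section Resample

variable {d N : ℕ} {G : Type*} [Group G] [TopologicalSpace G] [IsTopologicalGroup G]
  [CompactSpace G] [MeasurableSpace G] [BorelSpace G] (ρ : G →* Matrix (Fin N) (Fin N) ℂ)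

omit [CompactSpace G] [MeasurableSpace G] [BorelSpace G] in
/-- The partial staple form `g ↦ ∑_{p ∈ S} Re tr(ρ(g) ρ(staple_p^e(η)))` is continuous. [folklore] -/
theorem continuous_partial_sum (hρ : Continuous ρ) (e : Literature.MathematicalPhysics.QuantumLattice.ZdEdge d)
    (S : Finset (ZdPlaquette d)) (η : LGConfig d G) :
    Continuous fun g : G => ∑ p ∈ S, (ρ g * ρ (staple p e η)).trace.re := by
  refine continuous_finsetSum _ fun p _ => ?_
  simp_rw [← map_mul]
  exact (continuous_trace_re ρ hρ).comp (continuous_id.mul continuous_const)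

omit [TopologicalSpace G] [IsTopologicalGroup G] [CompactSpace G] [MeasurableSpace G] [BorelSpace G] in
/-- The partial staple form is bounded by `N` per plaquette. [folklore] -/
theorem abs_partial_sum_le (hρu : ∀ g, ρ g ∈ Matrix.unitaryGroup (Fin N) ℂ)
    (e : Literature.MathematicalPhysics.QuantumLattice.ZdEdge d) (S : Finset (ZdPlaquette d))
    (η : LGConfig d G) (g : G) :
    |∑ p ∈ S, (ρ g * ρ (staple p e η)).trace.re| ≤ S.card * N := by
  calc |∑ p ∈ S, (ρ g * ρ (staple p e η)).trace.re|
      ≤ ∑ p ∈ S, |(ρ g * ρ (staple p e η)).trace.re| := Finset.abs_sum_le_sum_abs _ _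
    _ ≤ ∑ _p ∈ S, (N : ℝ) := Finset.sum_le_sum fun p _ => by
        rw [← map_mul]; exact abs_re_trace_le_of_mem_unitaryGroup (hρu _)
    _ = S.card * N := by rw [Finset.sum_const, nsmul_eq_mul]

/-- **Resampling one private link.** Let `S` be a set of plaquettes through `e`, `p₁ ∈ S`, and
`f ≠ e` a link of `p₁` at which the staple of `p₁` at `e` is `a·h·b` in the variable `h` at `f`.
Then the Haar average over `h` of the squared partial staple form of `η^{f ← h}` is the squared
partial staple form of `S ∖ {p₁}` at `η` plus one full character variance:
`∫∫ (∑_{p ∈ S} Re tr(ρ(g) ρ(staple_p^e(η^{f←h}))))² dg dh = ∫ (∑_{p ∈ S∖p₁} …)² dg + V₀`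
(privacy `staple_update_eq_of_ne`, two-sided invariance `integral_add_reTr_sq`). [folklore] -/
theorem integral_integral_sq_sum_update (hρ : IsSpecialUnitaryModel ρ) (hN : 2 ≤ N)
    {e f : Literature.MathematicalPhysics.QuantumLattice.ZdEdge d} {S : Finset (ZdPlaquette d)}
    (hS : S ⊆ plaquettesTouching {e}) {p₁ : ZdPlaquette d} (hp₁ : p₁ ∈ S)
    (hfp : f ∈ plaquetteEdges p₁) (hfe : f ≠ e) (η : LGConfig d G) {a b : G}
    (hst : ∀ h : G, staple p₁ e (Function.update η f h) = a * h * b) :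
    ∫ h, ∫ g, (∑ p ∈ S, (ρ g * ρ (staple p e (Function.update η f h))).trace.re) ^ 2
        ∂haarProbability G ∂haarProbability G =
      ∫ g, (∑ p ∈ S.erase p₁, (ρ g * ρ (staple p e η)).trace.re) ^ 2 ∂haarProbability G +
        PlaquetteLowerBound.charVariance ρ := by
  haveI := IsSpecialUnitaryModel.secondCountableTopology ρ hρ
  have hep : ∀ p ∈ S, e ∈ plaquetteEdges p := fun p hp =>
    mem_plaquettesTouching_singleton.1 (hS hp)
  -- the other staples at `e` do not read `f`
  have hothers : ∀ p ∈ S.erase p₁, ∀ h : G,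
      staple p e (Function.update η f h) = staple p e η := by
    intro p hp h
    obtain ⟨hne, hpS⟩ := Finset.mem_erase.1 hp
    exact staple_update_eq_of_ne (hep p₁ hp₁) hfp hfe (hep p hpS) hne η h
  set A : G → ℝ := fun g => ∑ p ∈ S.erase p₁, (ρ g * ρ (staple p e η)).trace.re with hA
  have hsum : ∀ h g : G,
      ∑ p ∈ S, (ρ g * ρ (staple p e (Function.update η f h))).trace.re =
        A g + (ρ (g * a * h * b)).trace.re := by
    intro h g
    rw [← Finset.add_sum_erase S _ hp₁, hst h, add_comm, hA]
    simp only
    congr 1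
    · exact Finset.sum_congr rfl fun p hp => by rw [hothers p hp h]
    · rw [← map_mul]
      simp only [mul_assoc]
  simp_rw [hsum]
  have hAc : Continuous A := continuous_partial_sum ρ hρ.1 e (S.erase p₁) η
  have hFc : Continuous fun z : G × G => (A z.2 + (ρ (z.2 * a * z.1 * b)).trace.re) ^ 2 :=
    ((hAc.comp continuous_snd).add ((continuous_trace_re ρ hρ.1).comp
      (((continuous_snd.mul continuous_const).mul continuous_fst).mul continuous_const))).pow 2
  have hFi : Integrable (Function.uncurry fun h g : G => (A g + (ρ (g * a * h * b)).trace.re) ^ 2)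
      ((haarProbability G).prod (haarProbability G)) :=
    hFc.integrable_of_hasCompactSupport (HasCompactSupport.of_compactSpace _)
  rw [integral_integral_swap hFi]
  have hinner : ∀ g : G, ∫ h, (A g + (ρ (g * a * h * b)).trace.re) ^ 2 ∂haarProbability G =
      A g ^ 2 + PlaquetteLowerBound.charVariance ρ := fun g =>
    integral_add_reTr_sq ρ hρ hN (A g) (g * a) b
  simp_rw [hinner]
  have hi : Integrable (fun g : G => A g ^ 2) (haarProbability G) :=
    (hAc.pow 2).integrable_of_hasCompactSupport (HasCompactSupport.of_compactSpace _)
  rw [integral_add hi (integrable_const _)]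
  simp only [integral_const, probReal_univ, one_smul]
  rfl

end Resample

/-! ### Part C — the squared partial staple form through the DLR kernel at the private link -/

section Kernel

variable {d N : ℕ} {G : Type*} [Group G] [TopologicalSpace G] [IsTopologicalGroup G]
  [CompactSpace G] [MeasurableSpace G] [BorelSpace G] [SecondCountableTopology G] [T2Space G]
  (ρ : G →* Matrix (Fin N) (Fin N) ℂ)

omit [T2Space G] in
/-- The squared partial staple form `η ↦ ∫ (∑_{p ∈ S} Re tr(ρ(g) ρ(staple_p^e(η))))² dg` is a
measurable observable. [folklore] -/
theorem measurable_integral_sq_partial_sum (hρ : Continuous ρ)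
    (e : Literature.MathematicalPhysics.QuantumLattice.ZdEdge d) (S : Finset (ZdPlaquette d)) :
    Measurable fun η : LGConfig d G =>
      ∫ g, (∑ p ∈ S, (ρ g * ρ (staple p e η)).trace.re) ^ 2 ∂haarProbability G := by
  have hF : Continuous fun z : LGConfig d G × G =>
      (∑ p ∈ S, (ρ z.2 * ρ (staple p e z.1)).trace.re) ^ 2 := by
    refine (continuous_finsetSum _ fun p _ => ?_).pow 2
    simp_rw [← map_mul]
    exact (continuous_trace_re ρ hρ).comp
      (continuous_snd.mul ((continuous_staple p e).comp continuous_fst))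
  exact (hF.stronglyMeasurable.integral_prod_right' (ν := haarProbability G)).measurable

omit [SecondCountableTopology G] [T2Space G] in
/-- Bounds `0 ≤ ∫ (partial staple form)² ≤ (N #S)²`. [folklore] -/
theorem integral_sq_partial_sum_nonneg_le (hρu : ∀ g, ρ g ∈ Matrix.unitaryGroup (Fin N) ℂ)
    (e : Literature.MathematicalPhysics.QuantumLattice.ZdEdge d) (S : Finset (ZdPlaquette d))
    (η : LGConfig d G) :
    0 ≤ ∫ g, (∑ p ∈ S, (ρ g * ρ (staple p e η)).trace.re) ^ 2 ∂haarProbability G ∧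
      ∫ g, (∑ p ∈ S, (ρ g * ρ (staple p e η)).trace.re) ^ 2 ∂haarProbability G ≤
        (S.card * N) ^ 2 := by
  refine ⟨integral_nonneg fun g => sq_nonneg _, ?_⟩
  have hb : ∀ g, (∑ p ∈ S, (ρ g * ρ (staple p e η)).trace.re) ^ 2 ≤ (S.card * N) ^ 2 :=
    fun g => by
      have h := abs_partial_sum_le ρ hρu e S η g
      rw [← sq_abs]
      exact pow_le_pow_left₀ (abs_nonneg _) h 2
  calc ∫ g, (∑ p ∈ S, (ρ g * ρ (staple p e η)).trace.re) ^ 2 ∂haarProbability G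
      ≤ ∫ _g, ((S.card : ℝ) * N) ^ 2 ∂haarProbability G :=
        integral_mono_of_nonneg (ae_of_all _ fun g => sq_nonneg _) (integrable_const _)
          (ae_of_all _ hb)
    _ = (S.card * N) ^ 2 := by simp

/-- **The squared partial staple form through the DLR kernel at the private link.** With `S`,
`p₁`, `f` as in `integral_integral_sq_sum_update`, for every boundary condition `η` the one-link
kernel of the Wilson specification at `f` gives the squared partial staple form a mean
`≥ e^{-2βN #{p ∋ f}} (∫ (∑_{p ∈ S∖p₁} …)²(η) dg + V₀)` (kernel density `≥ e^{-osc}`). [folklore] -/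
theorem siteAvg_integral_sq_partial_sum_ge (hρ : IsSpecialUnitaryModel ρ) (hN : 2 ≤ N)
    {β : ℝ} (hβ : 0 ≤ β)
    {e f : Literature.MathematicalPhysics.QuantumLattice.ZdEdge d} {S : Finset (ZdPlaquette d)}
    (hS : S ⊆ plaquettesTouching {e}) {p₁ : ZdPlaquette d} (hp₁ : p₁ ∈ S)
    (hfp : f ∈ plaquetteEdges p₁) (hfe : f ≠ e)
    (hst : ∀ ω : LGConfig d G, ∃ a b : G, ∀ h : G, staple p₁ e (Function.update ω f h) = a * h * b)
    (η : LGConfig d G) :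
    Real.exp (-(β * (2 * N * (plaquettesTouching {f}).card))) *
        (∫ g, (∑ p ∈ S.erase p₁, (ρ g * ρ (staple p e η)).trace.re) ^ 2 ∂haarProbability G +
          PlaquetteLowerBound.charVariance ρ) ≤
      siteAvg (ymSpecification ρ β) f
        (fun η' : LGConfig d G =>
          ∫ g, (∑ p ∈ S, (ρ g * ρ (staple p e η')).trace.re) ^ 2 ∂haarProbability G) η := by
  have hu := IsSpecialUnitaryModel.mem_unitaryGroup ρ hρ
  have hγ := isSpecification_ymSpecification_of_t2Space (d := d) ρ hρ.1 β
  set Q : LGConfig d G → ℝ := fun η' =>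
    ∫ g, (∑ p ∈ S, (ρ g * ρ (staple p e η')).trace.re) ^ 2 ∂haarProbability G with hQ
  have hQm : Measurable Q := measurable_integral_sq_partial_sum ρ hρ.1 e S
  rw [siteAvg_eq_integral_siteLaw hγ f hQm η, siteLaw_ymSpecification_eq_tilted_haar ρ hρ.1 β f η]
  set D : ℝ := β * (2 * N * (plaquettesTouching {f}).card) with hD
  have hφm : Measurable fun h : G => -β * wilsonBoundaryAction ρ {f} (Function.update η f h) :=
    ((continuous_const.mul (continuous_wilsonBoundaryAction ρ hρ.1 {f})).measurable).comp
      (measurable_update η)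
  have hφ : ∀ᵐ h ∂haarProbability G, -D ≤ -β * wilsonBoundaryAction ρ {f} (Function.update η f h) ∧
      -β * wilsonBoundaryAction ρ {f} (Function.update η f h) ≤ -D + D := by
    refine ae_of_all _ fun h => ?_
    have hb := wilsonBoundaryAction_singleton_mem ρ hu f (Function.update η f h)
    constructor
    · rw [hD]; nlinarith [hb.2]
    · rw [neg_add_cancel]; nlinarith [hb.1]
  have hX := exp_neg_mul_integral_le_integral_tilted (ν := haarProbability G)
    (X := fun h => Q (Function.update η f h)) (hQm.comp (measurable_update η))
    (fun h => (integral_sq_partial_sum_nonneg_le ρ hu e S _).1)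
    (fun h => (integral_sq_partial_sum_nonneg_le ρ hu e S _).2) hφm hφ
  refine le_trans ?_ hX
  refine mul_le_mul_of_nonneg_left (le_of_eq ?_) (Real.exp_nonneg _)
  obtain ⟨a, b, hab⟩ := hst η
  exact (integral_integral_sq_sum_update ρ hρ hN hS hp₁ hfp hfe η hab).symm

end Kernel

end PlaquetteFirstMoment

end Summit.Ventures.YMGap.RobustBall
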